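import Literature.AlgebraicGeometry.Resolution.DeeplyRamifiedConjugates
import Mathlib.Algebra.Polynomial.Lifts
import HarnessLib

/-!
# Split extensions of deeply ramified fields (Temkin 2013, Cor. 3.1.10)

Topic: `Literature/AlgebraicGeometry/Resolution` (valued function fields). M. Temkin,
*Inseparable local uniformization*, J. Algebra 373 (2013) 65–119 = arXiv:0804.1554, §3.1
(numbering of the earlier arXiv version held in the literature store), continuing
`DeeplyRamifiedKrasner.lean` (Lemma 3.1.6) and `DeeplyRamifiedConjugates.lean` (Prop. 3.1.7):

> We say that an analytic `k`-field `K` is `k`-split if `inf_{c∈k} |T − c| = inf_{c∈k^a} |T − c|`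
> for any `T ∈ K` …
> **Corollary 3.1.10.** Assume that `k` is deeply ramified. Then `K` is `k`-split if and only if
> `k` is algebraically closed in `K`.

This is the step of the proof of Thm. 3.2.3 (Step 2: "`L` … is algebraically closed in `K` …
`K` is `L`-split by Corollary 3.1.10") that feeds the henselian-rationality machinery
(Kuhlmann 2019, §4–5, tree files `Kuhlmann2019*.lean`) with its standing hypothesis, the
transcendental approximation type (`SplitApproximationType.lean`), on the way to Thm. 3.3.1 = the
named fact `Temkin2013RelativeCurveSmoothFibre`. PROVED here in the equal characteristic case and
in the ambient rendering of the companion files (`(Ω, V)` algebraically closed of characteristic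
`p`; `E ≤ F ≤ Ω` with `E` henselian, perfect, of rank one; "complete" weakened to "henselian",
for `F` as well, which is what the proof uses).

## Content (everything PROVED; no definitions, no named facts)

* `mem_aroots_minpoly_of_forall_isAlgebraic_mem` — if every element of `F` algebraic over `E`
  lies in `E`, minimal polynomials over `E` and over `F` have the same roots [folklore].
* `valuation_le_sub_of_forall_isAlgebraic_mem_of_perfect` — **Cor. 3.1.10, "if"**: `E`
  algebraically closed in the henselian `F` ⇒ `F` is `E`-split [cite: Temkin2013, Cor. 3.1.10].
* `mem_of_isAlgebraic_of_split_of_perfect` — **Cor. 3.1.10, "only if"**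
  [cite: Temkin2013, Cor. 3.1.10].

## Sources

* M. Temkin, J. Algebra 373 (2013) = arXiv:0804.1554: §3.1, Lemma 3.1.3 (ii), Prop. 3.1.7,
  Cor. 3.1.10 and its proof (p. 22 of the held arXiv text); Thm. 3.2.3, Step 2 (p. 24).
  [Temkin2013]

## Rendering notes

* Splitness of `F` over `E` ("`inf_{c∈E} |T − c| = inf_{c∈E^a} |T − c|` for all `T ∈ F`"; the
  inequality `≥` being trivial) is rendered without real numbers as: for `T ∈ F` and `θ, g`
  algebraic over `E`, if `|g| ≤ |T − c|` for all `c ∈ E` then `|g| ≤ |T − θ|` — every algebraic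
  lower bound of the distances to `E` bounds the distance to every algebraic point (values of
  algebraic elements are dense around the infimum in rank one, cf. `DeeplyRamifiedKrasner.lean`).
-/

noncomputable section

open Polynomial IntermediateField

namespace Literature.AlgebraicGeometry.Resolution

universe u

variable {Ω : Type u} [Field Ω] [IsAlgClosed Ω] (V : ValuationSubring Ω)

/-! ### Minimal polynomials over a relatively algebraically closed subfield -/

section RelAlgClosed

omit V

/-- **Minimal polynomials do not change over a field in which the ground field is algebraically
closed**: for subfields `E ≤ F` of the algebraically closed `Ω` such that every element of `F`
algebraic over `E` lies in `E`, and `θ ∈ Ω` algebraic over `E`, every root in `Ω` of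
`minpoly_E θ` is a root of `minpoly_F θ` (so the two have the same roots; the coefficients of the
monic factor `minpoly_F θ` of `minpoly_E θ` are polynomials in conjugates of `θ`, hence algebraic
over `E`, hence in `E`). [folklore] -/
theorem mem_aroots_minpoly_of_forall_isAlgebraic_mem {E F : Subfield Ω} (hEF : E ≤ F)
    (hrel : ∀ a ∈ F, IsAlgebraic E a → a ∈ E) {θ : Ω} (hθ : IsIntegral E θ) {θ' : Ω}
    (hθ' : θ' ∈ (minpoly E θ).aroots Ω) : θ' ∈ (minpoly F θ).aroots Ω := by
  classical
  have hθF : IsIntegral F θ := isIntegral_of_subfield_le hEF hθ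
  set q : Polynomial Ω := (minpoly F θ).map (algebraMap F Ω) with hq
  set f : Polynomial Ω := (minpoly E θ).map (algebraMap E Ω) with hf
  have hqmonic : q.Monic := (minpoly.monic hθF).map _
  have hq0 : q ≠ 0 := hqmonic.ne_zero
  have hf0 : f ≠ 0 := ((minpoly.monic hθ).map _).ne_zero
  -- `q ∣ f` in `Ω[X]`
  have hqf : q ∣ f := by
    letI : Algebra E F := (Subfield.inclusion hEF).toAlgebra
    haveI : IsScalarTower E F Ω := IsScalarTower.of_algebraMap_eq fun _ => rfl
    have h1 : minpoly F θ ∣ (minpoly E θ).map (algebraMap E F) :=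
      minpoly.dvd_map_of_isScalarTower E F θ
    have h2 := Polynomial.map_dvd (algebraMap F Ω) h1
    rwa [Polynomial.map_map, ← IsScalarTower.algebraMap_eq] at h2
  -- the roots of `q` are roots of `f`, hence integral over `E`
  have hqsplits : q.Splits := IsAlgClosed.splits _
  have hroots : ∀ a ∈ q.roots, IsIntegral E a := by
    intro a ha
    have haf : a ∈ f.roots := Multiset.mem_of_le (Polynomial.roots.le_of_dvd hf0 hqf) ha
    rw [hf, mem_roots_map_of_injective (algebraMap E Ω).injective (minpoly.ne_zero hθ)] at haf
    exact ⟨minpoly E θ, minpoly.monic hθ, haf⟩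
  -- hence `q` lifts to the integral closure `R` of `E` in `Ω`, i.e. its coefficients are
  -- algebraic over `E`; they lie in `F`, hence in `E`
  set R : Subalgebra E Ω := integralClosure E Ω with hR
  have hqlifts : q ∈ Polynomial.lifts (algebraMap R Ω) := by
    rw [hqsplits.eq_prod_roots_of_monic hqmonic]
    refine Subsemiring.multiset_prod_mem _ _ fun r hr => ?_
    obtain ⟨a, ha, rfl⟩ := Multiset.mem_map.mp hr
    exact (Polynomial.mem_lifts _).mpr ⟨X - C (⟨a, hroots a ha⟩ : R), by
      rw [Polynomial.map_sub, map_X, map_C]; rfl⟩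
  have hcoeffE : ∀ n, q.coeff n ∈ E := by
    intro n
    obtain ⟨r, hr⟩ := (Polynomial.lifts_iff_coeff_lifts q).mp hqlifts n
    have hF : q.coeff n ∈ F := by
      rw [hq, coeff_map]
      exact SetLike.coe_mem _
    refine hrel _ hF ?_
    rw [← hr]
    exact (r.2 : IsIntegral E (r : Ω)).isAlgebraic
  -- so `q = q₀.map (E → Ω)` with `q₀ ∈ E[X]` monic vanishing at `θ`: `minpoly_E θ ∣ q₀`
  have hqliftsE : q ∈ Polynomial.lifts (algebraMap E Ω) := by
    rw [Polynomial.lifts_iff_coeff_lifts]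
    exact fun n => ⟨⟨q.coeff n, hcoeffE n⟩, rfl⟩
  obtain ⟨q₀, hq₀, -, hq₀monic⟩ := Polynomial.lifts_and_degree_eq_and_monic hqliftsE hqmonic
  have hq₀θ : aeval θ q₀ = 0 := by
    rw [aeval_def, ← eval_map, hq₀, hq, eval_map, ← aeval_def, minpoly.aeval]
  have hdvd : minpoly E θ ∣ q₀ := minpoly.dvd E θ hq₀θ
  -- `θ'` is a root of `minpoly_E θ`, hence of `q₀`, hence of `q`
  rw [mem_aroots] at hθ' ⊢
  refine ⟨minpoly.ne_zero hθF, ?_⟩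
  have h1 : aeval θ' q₀ = 0 := by
    obtain ⟨s, hs⟩ := hdvd
    rw [hs, map_mul, hθ'.2, zero_mul]
  have h2 : eval θ' q = 0 := by
    rw [← hq₀, eval_map, ← aeval_def, h1]
  rwa [hq, eval_map, ← aeval_def] at h2

end RelAlgClosed

/-! ### Temkin 2013, Cor. 3.1.10 -/

section Split

variable (p : ℕ) [hp : Fact p.Prime] [CharP Ω p] [CharP (IsLocalRing.ResidueField V) p]

/-- **Temkin 2013, Cor. 3.1.10, "if" (equal characteristic): an extension of a deeply ramified
field of height one in which the field is algebraically closed is split.** Let `Ω` be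
algebraically closed of characteristic `p` with valuation ring `V` (residue characteristic `p`),
`E ≤ F ≤ Ω` subfields with `E` henselian, perfect and of rank one, `F` henselian, and such that
every element of `F` algebraic over `E` lies in `E`. Then `F` is `E`-SPLIT: for `T ∈ F`, `θ`
algebraic over `E` and `g` algebraic over `E`, if `|g| ≤ |T − c|` for all `c ∈ E` then
`|g| ≤ |T − θ|` — no element of `F` is closer (by an algebraic margin) to an algebraic element than
to the whole of `E`; printed: "`K` is `k`-split if `inf_{c∈k} |T − c| = inf_{c∈k^a} |T − c|` for
any `T ∈ K` … Assume that `k` is deeply ramified. Then `K` is `k`-split if and only if `k` is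
algebraically closed in `K`." Printed proof (p. 22): if `|T − α| < inf_{c∈k} |T − c|` then
`|T − α| < inf_c |α − c|`, hence by Prop. 3.1.7 `|T − α| < |α − α'|` for a conjugate `α'` of `α`,
and then `k(T)` "contains a non-trivial extension of `k` by Lemma 3.1.3 (ii)" — here: `α'` would
be an `F`-conjugate of `α` (`mem_aroots_minpoly_of_forall_isAlgebraic_mem`), but conjugation over
the henselian `F` preserves `|· − T|`. ("Complete" is weakened to "henselian" throughout.) PROVED.
[cite: Temkin2013, Cor. 3.1.10] -/
theorem valuation_le_sub_of_forall_isAlgebraic_mem_of_perfect {E F : Subfield Ω} (hEF : E ≤ F)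
    (hE : IsHenselianField E (V.comap (algebraMap E Ω))) (hperf : ∀ y ∈ E, ∃ b ∈ E, b ^ p = y)
    (hr1 : IsRankOneValued V E) (hF : IsHenselianField F (V.comap (algebraMap F Ω)))
    (hrel : ∀ a ∈ F, IsAlgebraic E a → a ∈ E) {T : Ω} (hT : T ∈ F) {θ : Ω}
    (hθ : IsAlgebraic E θ) {g : Ω} (hgalg : IsAlgebraic E g)
    (hg : ∀ c ∈ E, V.valuation g ≤ V.valuation (T - c)) :
    V.valuation g ≤ V.valuation (T - θ) := by
  by_contra hlt
  push Not at hlt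
  -- `|θ - c| = |T - c| ≥ |g|` for `c ∈ E`
  have hθc : ∀ c ∈ E, V.valuation g ≤ V.valuation (θ - c) := by
    intro c hc
    have h1 : V.valuation (T - θ) < V.valuation (T - c) := lt_of_lt_of_le hlt (hg c hc)
    have hid : θ - c = (T - c) - (T - θ) := by ring
    rw [hid, Valuation.map_sub_eq_of_lt_left _ h1]
    exact hg c hc
  -- Prop. 3.1.7: a conjugate `θ'` of `θ` over `E` with `|g| ≤ |θ - θ'|`
  obtain ⟨θ', hθ', hgθ'⟩ :=
    exists_aroots_valuation_le_of_perfect V p hE hperf hr1 hθ.isIntegral hgalg hθc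
  have hfar : V.valuation (T - θ) < V.valuation (θ - θ') := lt_of_lt_of_le hlt hgθ'
  -- `|θ' - T| = |θ - θ'| > |θ - T|`
  have hne : V.valuation (θ' - T) ≠ V.valuation (θ - T) := by
    have hid : θ' - T = -((θ - θ') + (T - θ)) := by ring
    rw [hid, Valuation.map_neg, Valuation.map_add_eq_of_lt_left _ hfar, Valuation.map_sub_swap V.valuation θ T]
    exact (ne_of_lt hfar).symm
  -- but `θ'` is an `F`-conjugate of `θ`, and conjugation over the henselian `F` preserves `|· - T|`
  have hθ'F : θ' ∈ (minpoly F θ).aroots Ω :=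
    mem_aroots_minpoly_of_forall_isAlgebraic_mem hEF hrel hθ.isIntegral hθ'
  have hθF : IsAlgebraic F θ := isAlgebraic_of_subfield_le hEF hθ
  have hconj : IsConjRoot F θ θ' := (isConjRoot_iff_mem_minpoly_aroots hθF.isIntegral).mpr hθ'F
  have key := hF.valuation_aeval_eq_of_isConjRoot_of_subfield V hθF hconj (X - C (⟨T, hT⟩ : F))
  have h1 : aeval θ (X - C (⟨T, hT⟩ : F)) = θ - T := by simp; rfl
  have h2 : aeval θ' (X - C (⟨T, hT⟩ : F)) = θ' - T := by simp; rfl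
  rw [h1, h2] at key
  exact hne key.symm

omit [CharP (IsLocalRing.ResidueField V) p] in
/-- **Temkin 2013, Cor. 3.1.10, "only if": a split extension of a perfect henselian field contains
no new algebraic elements** ("Obviously, if `K` is `k`-split then `k^a ∩ K = k`"). For subfields
`E, F ≤ Ω` with `E` henselian and perfect (characteristic `p`), if `F` is `E`-split in the sense of
`valuation_le_sub_of_forall_isAlgebraic_mem_of_perfect` (tested on `g` algebraic over `E`), then
every `θ ∈ F` algebraic over `E` lies in `E`: otherwise `θ` has a conjugate `θ₀ ≠ θ` (separability),
`g = θ − θ₀` is a lower bound of `{|θ − c| : c ∈ E}` by Krasner's lemma, and splitness at `T = θ`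
would give `0 < |g| ≤ |θ − θ| = 0`. PROVED. [cite: Temkin2013, Cor. 3.1.10] -/
theorem mem_of_isAlgebraic_of_split_of_perfect {E F : Subfield Ω}
    (hE : IsHenselianField E (V.comap (algebraMap E Ω))) (hperf : ∀ y ∈ E, ∃ b ∈ E, b ^ p = y)
    (hsplit : ∀ T ∈ F, ∀ θ : Ω, IsAlgebraic E θ → ∀ g : Ω, IsAlgebraic E g →
      (∀ c ∈ E, V.valuation g ≤ V.valuation (T - c)) → V.valuation g ≤ V.valuation (T - θ))
    {θ : Ω} (hθF : θ ∈ F) (hθ : IsAlgebraic E θ) : θ ∈ E := by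
  classical
  -- `E` is perfect, hence `minpoly_E θ` is separable
  haveI : ExpChar E p := ExpChar.prime hp.out
  haveI : PerfectRing E p := PerfectRing.ofSurjective E p fun y => by
    obtain ⟨b, hb, h⟩ := hperf y y.2
    exact ⟨⟨b, hb⟩, Subtype.ext (by simpa [frobenius] using h)⟩
  haveI : PerfectField E := PerfectRing.toPerfectField E p
  have hint : IsIntegral E θ := hθ.isIntegral
  have hsep : (minpoly E θ).Separable := PerfectField.separable_of_irreducible (minpoly.irreducible hint)
  by_contra hθE
  -- a conjugate `θ₀ ≠ θ`
  have hdeg : 1 < (minpoly E θ).natDegree := by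
    refine lt_of_le_of_ne (minpoly.natDegree_pos hint) fun h1 => hθE ?_
    obtain ⟨c, hc⟩ := minpoly.natDegree_eq_one_iff.mp h1.symm
    rw [← hc]
    exact c.2
  have hcard : ((minpoly E θ).aroots Ω).toFinset.card = (minpoly E θ).natDegree := by
    have hnodup : ((minpoly E θ).aroots Ω).Nodup := nodup_roots hsep.map
    rw [Multiset.toFinset_card_of_nodup hnodup]
    exact (aeval_minpoly_eq_prod_aroots hint).2
  obtain ⟨θ₀, hθ₀, hne⟩ : ∃ θ₀ ∈ (minpoly E θ).aroots Ω, θ₀ ≠ θ := by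
    by_contra hall
    push Not at hall
    have hsub : ((minpoly E θ).aroots Ω).toFinset ⊆ {θ} := fun x hx =>
      Finset.mem_singleton.mpr (hall x (Multiset.mem_toFinset.mp hx))
    have := Finset.card_le_card hsub
    rw [hcard, Finset.card_singleton] at this
    exact absurd hdeg (not_lt.mpr this)
  -- `g = θ - θ₀` is a lower bound of the distances `|θ - c|`, `c ∈ E` (Krasner)
  have hg : ∀ c ∈ E, V.valuation (θ - θ₀) ≤ V.valuation (θ - c) := fun c hc =>
    valuation_sub_le_of_mem_aroots_minpoly V hE hint hθ₀ hc
  have hθ₀int : IsIntegral E θ₀ :=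
    (IsConjRoot.isIntegral_iff ((isConjRoot_iff_mem_minpoly_aroots hint).mpr hθ₀)).mp hint
  have hgalg : IsAlgebraic E (θ - θ₀) := (hint.sub hθ₀int).isAlgebraic
  have h := hsplit θ hθF θ hθ (θ - θ₀) hgalg hg
  rw [sub_self, map_zero, le_zero_iff, map_eq_zero, sub_eq_zero] at h
  exact hne h.symm

end Split

end Literature.AlgebraicGeometry.Resolution
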